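/-
Copyright (c) 2026 the pub-hodgecm-mathlib formalisation cell (harness21).  Prover seat hodgecm-mathlib-K2Liu-p08 (g0), Track B «K2-LIT»,
#184♮ = hLiu418 = `stmt-HodgeConjecture-24832`; K2E5-plan (g5) CO-DEAL 2026-09-04T06:07:47Z (M-156c co-dealer rule) ROAD I v3 brick U0
`Theorems/K2LiuFirstTermResidueForm.lean` — DEFS leaf (the one definition `resNorm`).
-/
import Mathlib.Analysis.Complex.Basic
import Mathlib.Algebra.BigOperators.Group.Finset.Basic
import HarnessLib

/-!
# Crux `HLiu418`, Road I v3 (first-term identity #42F′ by uniqueness), brick U0 — DEFS leaf: the NORMALISED RESIDUE at `s = ½` of a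
# pole-cleared continuation `(P, E⋆)`

Cell `hodgecm-mathlib`, crux item hLiu418 = `stmt-HodgeConjecture-24832`; road-map owner ∕ co-dealer K2E5-plan (g5) (binder sheet
`K2/K2E5-plan/g5/SIGS-RoadI-v3.md` §U0), LEAD F0P6-plan (g12).  DEFINITION WITH BODY + `rfl` API only (no instance, no notation, no named-fact hypothesis,
no `sorry`); lane `--supports stmt-HodgeConjecture-24832 --as helper` (count-neutral; a definition ⇒ async audit).  Consumer: the theorem file
`Theorems/K2LiuFirstTermResidueForm.lean` (U0.1–U0.4) and every U-organ of Road I v3 (U1, U3, U5; the #42F′ closer).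

THE OBJECT.  Socket #41 `sig_K2LiuSiegelEisensteinContinuation` (U6 ED. 10 :267) delivers, for a standard family `f` of Siegel sections on
`H(𝔸) = U(V ⊕ −V)(𝔸_{L⁺})`, a FINITE set `P ⊂ ℂ` and a pole-cleared continuation `E⋆ : ℂ → H(𝔸) → ℂ` of `∏_{p∈P}(s − p) · E^Δ(·; f_s)`, holomorphic
on `{Re s > 0}`.  The residue of the Eisenstein series at the top pole `s = ½` (the quantity of [KudlaRallis1994, Thm. 1.1] ∕ [Liu2021, Lem. B.12]
∕ [GanQiuTakeda2014, Thm. 20 (i)]) is then the NUMBER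
  `resNorm P E⋆ h := E⋆(½, h) / ∏_{p ∈ P ∖ {½}} (½ − p)`   if `½ ∈ P`,   and `0` if `½ ∉ P`
(no limit in the definition: simple poles only, so the residue is a VALUE of the holomorphic `E⋆`).  The theorem file proves that it IS the
`𝓝[≠] ½`-limit of `(s − ½) · E⋆(s, h)/∏_P(s − p)` (U0.1), that it depends only on `f` and not on the chosen `(P, E⋆)` (U0.2, identity theorem on
`{Re s > 0}`), that it is a continuous left-`H(L⁺)`-invariant function of moderate growth (U0.3), and that it is linear in `f` (U0.4).  The
argument type `X` is arbitrary (`X = H(𝔸)` in the applications).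
[KudlaRallis1994, §1 Thm. 1.1] [Liu2021, App. B Lem. B.10 (2), B.12 pp. 102–104] [Tan1999, §1].
HONEST LABEL.  Count-neutral DEFS leaf, pays nothing by itself; `HC_CM` is proved only modulo the 7 printed citations (2 remaining named inputs:
hLiu418 = `stmt-HodgeConjecture-24832`, h413 = `stmt-HodgeConjecture-24833`) until rung 0 closes.
-/

set_option autoImplicit false
set_option linter.dupNamespace false -- the mandated namespace repeats `HodgeConjecture.HodgeConjecture`

noncomputable section

namespace Summit.HodgeConjecture.HodgeConjecture.Cruxes.HLiu418.K2LiuFirstTermResidueFormDefs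

open scoped BigOperators

/-- **The normalised residue at `s = ½` of a pole-cleared continuation `(P, E⋆)`**: `E⋆(½, h) / ∏_{p ∈ P ∖ {½}} (½ − p)` if `½ ∈ P`, else `0`
(for `E⋆ = ∏_{p∈P}(s − p)·E(s, ·)` with `E` meromorphic with at most simple poles inside `P`, this is `Res_{s=½} E(s, h)`).
[cite: KudlaRallis1994, §1 Thm. 1.1] [cite: Liu2021, Lem. B.12 pp. 103–104] [cite: Tan1999, §1] -/
def resNorm {X : Type*} (P : Finset ℂ) (Es : ℂ → X → ℂ) (h : X) : ℂ :=
  if (1 / 2 : ℂ) ∈ P then Es (1 / 2) h / ∏ p ∈ P.erase (1 / 2), ((1 / 2 : ℂ) - p) else 0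

/-- unfolding. [cite: KudlaRallis1994, §1 Thm. 1.1] -/
theorem resNorm_def {X : Type*} (P : Finset ℂ) (Es : ℂ → X → ℂ) (h : X) :
    resNorm P Es h = if (1 / 2 : ℂ) ∈ P then Es (1 / 2) h / ∏ p ∈ P.erase (1 / 2), ((1 / 2 : ℂ) - p) else 0 :=
  rfl

/-- the pole case `½ ∈ P`. [cite: KudlaRallis1994, §1 Thm. 1.1] -/
theorem resNorm_of_mem {X : Type*} {P : Finset ℂ} (hP : (1 / 2 : ℂ) ∈ P) (Es : ℂ → X → ℂ) (h : X) :
    resNorm P Es h = Es (1 / 2) h / ∏ p ∈ P.erase (1 / 2), ((1 / 2 : ℂ) - p) :=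
  if_pos hP

/-- the holomorphic case `½ ∉ P`: the residue is `0`. [cite: KudlaRallis1994, §1 Thm. 1.1] -/
theorem resNorm_of_not_mem {X : Type*} {P : Finset ℂ} (hP : (1 / 2 : ℂ) ∉ P) (Es : ℂ → X → ℂ) (h : X) :
    resNorm P Es h = 0 :=
  if_neg hP

/-- as a function of `h` in the pole case: a constant multiple of `E⋆(½, ·)`. [cite: Liu2021, Lem. B.12 pp. 103–104] -/
theorem resNorm_eq_const_mul_of_mem {X : Type*} {P : Finset ℂ} (hP : (1 / 2 : ℂ) ∈ P) (Es : ℂ → X → ℂ) :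
    resNorm P Es = fun h => (∏ p ∈ P.erase (1 / 2), ((1 / 2 : ℂ) - p))⁻¹ * Es (1 / 2) h := by
  funext h
  rw [resNorm_of_mem hP, div_eq_inv_mul]

/-- as a function of `h` in the holomorphic case: identically `0`. [cite: Liu2021, Lem. B.12 pp. 103–104] -/
theorem resNorm_eq_zero_of_not_mem {X : Type*} {P : Finset ℂ} (hP : (1 / 2 : ℂ) ∉ P) (Es : ℂ → X → ℂ) :
    resNorm P Es = fun _ => 0 := by
  funext h
  exact resNorm_of_not_mem hP Es h

/-- the normalising denominator `∏_{p ∈ P ∖ {½}} (½ − p)` never vanishes. [folklore] -/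
theorem prod_erase_half_sub_ne_zero (P : Finset ℂ) : ∏ p ∈ P.erase (1 / 2), ((1 / 2 : ℂ) - p) ≠ 0 :=
  Finset.prod_ne_zero_iff.2 fun _ hp => sub_ne_zero.2 (Finset.ne_of_mem_erase hp).symm

end Summit.HodgeConjecture.HodgeConjecture.Cruxes.HLiu418.K2LiuFirstTermResidueFormDefs

end
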